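import Literature.NumberTheory.EllipticCurves.FormalGroupMultiplication
import Literature.NumberTheory.EllipticCurves.FormalGroupLawChordFormulaProofs
import HarnessLib

/-!
# `[p](T) = p f(T) + g(T^p)` with `f, g ∈ ℤ⟦T⟧` for a Weierstrass equation over `ℤ` (Silverman AEC IV.4.4)

Trunk `Literature/NumberTheory/EllipticCurves`; sequel of `FormalGroupMultiplication`, which proves Silverman's
AEC IV.4.4 for a `p`-integral equation over `ℚ_p`: every coefficient of the multiplication-by-`p` series `[p](T)`
in a degree NOT divisible by `p` has norm `≤ ‖p‖` (`WeierstrassCurve.norm_coeff_formalMul_prime_le`), whence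
`[p](T) = p·f(T) + g(T^p)` with `f, g ∈ ℤ_p⟦T⟧` (`formalMul_prime_eq_add_subst_X_pow`, parts `formalMulPRemPart`,
`formalMulPDivPart`). Here the same decomposition is written over `ℤ` for a Weierstrass equation with INTEGER
coefficients (e.g. a global minimal model of an elliptic curve over `ℚ`): the formal group law and `[p]` have
coefficients in `ℤ[a₁,…,a₆]` (`map_formalMul`), and `p ∣ [Tᵏ][p]` in `ℤ` for `p ∤ k`
(`prime_dvd_coeff_formalMul_prime`, from the `ℚ_p`-statement and `padicNormE.norm_int_le_pow_iff_dvd`), so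

* `formalMulPDivPartInt W = g = Σₖ [T^{pk}][p] · sᵏ ∈ ℤ⟦s⟧`, `formalMulPRemPartInt W = f = Σ_{p ∤ k} ([Tᵏ][p]/p) Tᵏ`,
* **`formalMul_prime_eq_add_subst_X_pow_int : W.formalMul p = p · f + g(T^p)`** in `ℤ⟦T⟧`, both parts without
  constant term.

This is the input of the contracting property of `[p]` on the points of `Ê` with values in Fontaine's `𝔸_inf`
(`Literature/NumberTheory/PAdicHodge/AinfPSeriesContracting.lean`). No named facts, no `sorry`.

## References
* J. H. Silverman, *The Arithmetic of Elliptic Curves*, 2nd ed. (2009), IV.4.4 and Cor. IV.4.3. [SilvermanAEC2009]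
-/

noncomputable section

open scoped Classical
open PowerSeries Literature.NumberTheory.EllipticCurves

namespace WeierstrassCurve

variable {p : ℕ} [Fact p.Prime] (W : WeierstrassCurve ℤ)

/-- The `ℚ_p`-model of an integral Weierstrass equation is `p`-integral. [folklore] -/
instance isIntegral_padicInt_map_int : (W.map (Int.castRingHom ℚ_[p])).IsIntegral ℤ_[p] := by
  have hφ : PadicInt.Coe.ringHom.comp (Int.castRingHom ℤ_[p]) = Int.castRingHom ℚ_[p] := RingHom.ext_int _ _
  have h : W.map (Int.castRingHom ℚ_[p]) = (W.map (Int.castRingHom ℤ_[p])).map PadicInt.Coe.ringHom := by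
    rw [map_map, hφ]
  rw [h]
  exact isIntegral_map_coe _

/-- Coefficients of `[p]` over `ℚ_p` are the integer ones. [cite: SilvermanAEC2009, IV.4.4] -/
theorem coeff_formalMul_map_int (n k : ℕ) :
    coeff k ((W.map (Int.castRingHom ℚ_[p])).formalMul n) = ((coeff k (W.formalMul n) : ℤ) : ℚ_[p]) := by
  rw [← map_formalMul, coeff_map, eq_intCast]

/-- **AEC IV.4.4 over `ℤ`**: `p ∣ [Tᵏ][p](T)` in `ℤ` for every `k` not divisible by `p`.
[cite: SilvermanAEC2009, IV.4.4] -/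
theorem prime_dvd_coeff_formalMul_prime {k : ℕ} (hk : ¬ p ∣ k) : (p : ℤ) ∣ coeff k (W.formalMul p) := by
  have h := (W.map (Int.castRingHom ℚ_[p])).norm_coeff_formalMul_prime_le hk
  rw [coeff_formalMul_map_int, Padic.norm_p] at h
  have h2 := (Padic.norm_int_le_pow_iff_dvd (p := p) (coeff k (W.formalMul p)) 1).1
    (by rw [Nat.cast_one, zpow_neg, zpow_one]; exact h)
  simpa using h2

/-- **`g`** in `[p](T) = p f(T) + g(T^p)` over `ℤ`: `g(s) = Σₖ [T^{pk}][p] · sᵏ`. [cite: SilvermanAEC2009, IV.4.4] -/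
def formalMulPDivPartInt (W : WeierstrassCurve ℤ) : ℤ⟦X⟧ :=
  PowerSeries.mk fun k => coeff (p * k) (W.formalMul p)

/-- **`f`** in `[p](T) = p f(T) + g(T^p)` over `ℤ`: `f(T) = Σ_{p ∤ k} ([Tᵏ][p] / p) · Tᵏ` (exact division by
`prime_dvd_coeff_formalMul_prime`). [cite: SilvermanAEC2009, IV.4.4] -/
def formalMulPRemPartInt (W : WeierstrassCurve ℤ) : ℤ⟦X⟧ :=
  PowerSeries.mk fun k => if p ∣ k then 0 else coeff k (W.formalMul p) / p

/-- **AEC IV.4.4 over `ℤ`: `[p](T) = p·f(T) + g(T^p)` in `ℤ⟦T⟧`.** [cite: SilvermanAEC2009, IV.4.4] -/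
theorem formalMul_prime_eq_add_subst_X_pow_int :
    W.formalMul p = (p : ℤ⟦X⟧) * W.formalMulPRemPartInt (p := p) +
      (W.formalMulPDivPartInt (p := p)).subst ((X : ℤ⟦X⟧) ^ p) := by
  have hp : p.Prime := Fact.out
  ext k
  rw [map_add, ← map_natCast (C (R := ℤ)) p, coeff_C_mul, formalMulPRemPartInt, coeff_mk, formalMulPDivPartInt,
    coeff_subst_X_pow hp.ne_zero, coeff_mk]
  by_cases hk : p ∣ k
  · rw [if_pos hk, if_pos hk, mul_zero, zero_add, Nat.mul_div_cancel' hk, Algebra.algebraMap_self_apply]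
  · rw [if_neg hk, if_neg hk, add_zero, Int.mul_ediv_cancel' (W.prime_dvd_coeff_formalMul_prime hk)]

omit [Fact p.Prime] in
/-- `g(0) = 0`. [cite: SilvermanAEC2009, IV.4.4] -/
@[simp] theorem constantCoeff_formalMulPDivPartInt : constantCoeff (W.formalMulPDivPartInt (p := p)) = 0 := by
  rw [← coeff_zero_eq_constantCoeff_apply, formalMulPDivPartInt, coeff_mk, mul_zero, coeff_zero_eq_constantCoeff_apply,
    constantCoeff_formalMul]

omit [Fact p.Prime] in
/-- `f(0) = 0`. [cite: SilvermanAEC2009, IV.4.4] -/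
@[simp] theorem constantCoeff_formalMulPRemPartInt : constantCoeff (W.formalMulPRemPartInt (p := p)) = 0 := by
  rw [← coeff_zero_eq_constantCoeff_apply, formalMulPRemPartInt, coeff_mk, if_pos (dvd_zero p)]

omit [Fact p.Prime] in
/-- `g'(0) = [T^p][p]` (the Hasse-invariant coefficient modulo `p`). [cite: SilvermanAEC2009, IV.4.4] -/
theorem coeff_one_formalMulPDivPartInt : coeff 1 (W.formalMulPDivPartInt (p := p)) = coeff p (W.formalMul p) := by
  rw [formalMulPDivPartInt, coeff_mk, mul_one]

end WeierstrassCurve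

end
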